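import Summits.QuantumFields.YangMills.Theorems.FluctuationComparisonRegPrIntLS2BetaResidualGauge
import Literature.MathematicalPhysics.QuantumFieldTheory.Balaban1983to89.T3Thm1UniquenessSchema
import Literature.MathematicalPhysics.QuantumFieldTheory.Balaban1983to89.T3PrintedMinimiserExistence
import Literature.MathematicalPhysics.QuantumFieldTheory.Balaban1983to89.T3InteriorExcision
import HarnessLib

/-!
# ORB «`argminHist V` is ONE residual orbit» FROM PRINT'S UNIQUENESS LETTER — the door, the shallow-depth case, and the one displayed letter REG-ARGMIN
# (crux `FluctuationComparisonRegPrIntL`, stmt-QuantumFields-20520; registry v11.4 `Cruxes/FluctuationComparisonRegPrIntL/Lines/semiclassical_s2beta.lean` 3732b7df, organ GAP♯∘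
# `UniformFibreGapOrbit` l.768, R590 (18) item (3); px13 g17 LOCATE-GAP♯ §3 (a), px17 g14 LOCATE-ORB e47193f2)

Cell `ym3-torus` (YM ladder rung R3 = continuum `SU(2)` Yang–Mills on the three-torus — a RUNG, NOT d = 4, NOT infinite volume, NOT a mass gap, NOT Clay); width seat `ym3-torus-px17`
(gen 14); `--supports stmt-QuantumFields-20520 --as helper`, count-neutral, definition-free, default heartbeats.  WHAT.  ✓`…S2BetaResidualGaugeOrbit.argmin_eq_orbit_of_gapOrbit` derives ORB from GAP♯∘; the converse programme (GAP♯∘ ⟸ ORB + slice-Hessian positivity + tube exit) wants ORB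
from PRINT — [Balaban1985Variational] Thm 1 sentence 2 ∕ Prop. 7 clause 1, typed as lit ✓`T3Thm1UniquenessSchema.Thm1UniqueMinOrbitAt` ∕ `Prop7AtMostOneCriticalOrbitAt` at the
carriers `T3Thm1Carrier.varProblem3`.  Both printed letters speak ONLY of configurations in print's space (6) = `regFibrePr F J K hJK ε₀ V` (`RegPr`: plaquettes `< ε₀L^{−2(K−J)}`
AND covariant divergence of the curvature `< ε₀L^{−3(K−J)}`), whereas `argminHist V` (registry l.725) consists of GOOD-HISTORY fields achieving the (6)-minimum — and `histGood`'s
only finest-level clause, `PlaqSmall (θBal F.L γ b₀ p₀ K)`, is far weaker than (6) at depth `K − J ≳ K/4`.  So: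
* §1 THE POINTWISE DOOR: at one datum, print's «at most one critical orbit in (6)(ε₀)» (or the Thm-1 pair: existence in (8) + «unique critical orbit in (6)») sends any two points
  of `argminHist V` THAT ARE (6)-REGULAR onto ONE residual orbit — a (6)-regular (6)-action-achiever minimises over (6) (✓`minActionRegPr_le`), print's sheet `u↓ = 1` is residual
  (✓`residual_of_descTransf_eq_one`), two sheets over one base compose to a residual `u₁u₀⁻¹` (✓`residual_mul`, ✓`residual_inv`, ✓`gaugeAct_mul_eq`).
* §2 SHALLOW DEPTH IS FREE: if `θBal(K) ≤ regThreshold F J K ε₀` and `4θBal(K) < ε₀L^{−3(K−J)}`, every good-history field is (6)-regular (lit ✓`regPr_of_plaqSmall` on the `j = 0`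
  clause), so REG-ARGMIN(V) := «every point of `argminHist V` is (6)-regular» holds; one smallness `θBal(K) ≤ ε₀L^{−3d}/5` serves every depth `K − J ≤ d`.
* §3 THE WINDOW THEOREMS: ★★ `argmin_eq_orbit_of_prop7_of_regArgmin` — GAP♯∘'s quantifier prefix and interior window VERBATIM (no `μ`), conclusion «REG-ARGMIN(V) → ∀ U₀ ∈
  argminHist V, argminHist V = {w • U₀ | w residual}» from the Prop-7 letter `∀ L, Odd L → 1 < L → ∃ a₀ B₃ > 0, Prop7AtMostOneCriticalOrbitAt L a₀ B₃` ALONE, REG-ARGMIN DISPLAYED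
  as an inner hypothesis; ★★ `argmin_eq_orbit_of_prop7_of_depth_le` — at BOUNDED depth `K − J ≤ d` (thresholds depending on `d`) ORB OUTRIGHT from the Prop-7 letter; ★
  `argmin_eq_orbit_of_thm1Pair_of_regArgmin` — ★★₁ from the Thm-1 pair letter `∀ L, Odd L → 1 < L → ∃ a₀ a₁ B₃ > 0, Thm1GlobalMinAt L a₀ a₁ B₃ ∧ Thm1UniqueMinOrbitAt L a₀ a₁ B₃`.

NET (registry granularity, CREDIT NOTHING): ORB ⟸ {print's uniqueness letter, REG-ARGMIN}; REG-ARGMIN is free at bounded depth and is NOT a printed statement at unbounded depth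
([Balaban1985UV3] integrates one level per step, (41) p.266 → (51) p.268, with ONE-STEP closeness only, p.259 ∕ p.268); since GAP♯∘ ⇒ ORB (✓) and (6) is residual-invariant
(✓`gaugeAct_mem_regFibrePr_iff_of_residual`), GAP♯∘ itself implies REG-ARGMIN's orbit form — REG-ARGMIN is GAP♯∘'s qualitative core, now a NAMED hypothesis.  HONEST: doors over
landed letters; the schemas are HYPOTHESES (never asserted); ORB at unbounded depth, REG-ARGMIN, GAP♯∘, EXW∘, S2β, `FluctuationComparisonRegPrIntL` (20520), EX (19200) are NOT
proved here; no summit is proved by a helper; rung R3 = SU(2) YM₃ on T³ — NOT d = 4, NOT infinite volume, NOT a mass gap, NOT Clay.  Sorry-free, axioms standard.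
DOCKING (Cruxes workfiles cannot be imported): `argminHist …` and `ResidualGauge F hJK` ↦ their v11.4 bodies (the two RG-K substitutions of ✓`…S2BetaResidualGaugeOrbit`).

References: T. Bałaban, CMP **102** (1985) 277–309 [Balaban1985Variational] ((2)–(8) p.278, Thm 1 p.279, Prop. 7 p.299, (142) p.299); CMP **102** (1985) 255–275 [Balaban1985UV3]
((7) p.257, p.259, (41) p.266, p.268); CMP **99** (1985) 75–102 [Balaban1985RegularSpaces] ((1.7)–(1.9) p.77, Lemma 1); CMP **98** (1985) 17–51 [Balaban1985Averaging] ((8), (11) p.19).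
-/

set_option autoImplicit false

noncomputable section
namespace Summit.QuantumFields.YangMills.Theorems.FluctuationComparisonRegPrIntLArgminOrbitOfUniqueCriticalOrbit

open Set
open Literature.MathematicalPhysics.QuantumFieldTheory.Balaban1983to89
open Literature.MathematicalPhysics.QuantumFieldTheory.Balaban1983to89.T3ContinuumYM3Torus
open Literature.MathematicalPhysics.QuantumFieldTheory.Balaban1983to89.T3UnitLawDensityEML (ℰp)
open Literature.MathematicalPhysics.QuantumFieldTheory.Balaban1983to89.T3UnitScaleTilt
open Literature.MathematicalPhysics.QuantumFieldTheory.Balaban1983to89.T3TiltDescent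
open Literature.MathematicalPhysics.QuantumFieldTheory.Balaban1983to89.T3ConstrainedMinimiser (fibre)
open Literature.MathematicalPhysics.QuantumFieldTheory.Balaban1983to89.T3DescentFibreTower
open Literature.MathematicalPhysics.QuantumFieldTheory.Balaban1983to89.T3RegularMinimiser
open Literature.MathematicalPhysics.QuantumFieldTheory.Balaban1983to89.T3PrintedRegularMinimiser
open Literature.MathematicalPhysics.QuantumFieldTheory.Balaban1983to89.T3PrintedRegularOrbits (descTransf)
open Literature.MathematicalPhysics.QuantumFieldTheory.Balaban1983to89.T3PrintedMinimiserExistence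
open Literature.MathematicalPhysics.QuantumFieldTheory.Balaban1983to89.T3Thm1Carrier (varProblem3)
open Literature.MathematicalPhysics.QuantumFieldTheory.Balaban1983to89.T3Thm1UniquenessSchema (Thm1UniqueMinOrbitAt Prop7AtMostOneCriticalOrbitAt)
open Literature.MathematicalPhysics.QuantumFieldTheory.Balaban1983to89.T3MinimiserStabilityReduction (θBal_pos)
open Literature.MathematicalPhysics.QuantumFieldTheory.Balaban1983to89.T3ThresholdSmallness (exists_forall_θBal_le)
open Literature.MathematicalPhysics.QuantumFieldTheory.Balaban1983to89.T3InteriorExcision (θBal_mul θBal_mul_le)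
open Literature.MathematicalPhysics.QuantumFieldTheory.Balaban1983to89.T3AvgDivergenceSplit (regPr_of_plaqSmall)
open Literature.MathematicalPhysics.QuantumFieldTheory.Balaban1983to89.Missing
open Literature.MathematicalPhysics.QuantumFieldTheory.Balaban1983to89.T4Continuum
open Summit.QuantumFields.YangMills.Theorems.FluctuationComparisonRegPrIntLS2BetaResidualGauge

/-! ## §1 The pointwise door: (6)-regular points of `argminHist V` lie on one residual orbit -/

section Door
variable (F : T3Family) {J K : ℕ} (hJK : J ≤ K) {γ b₀ p₀ ε₀ : ℝ}

/-- A good-history field achieving the (6)-minimum which is itself (6)-regular lies in (6) and MINIMISES the Wilson action over (6) (`A(U) = sInf ≤ A(W)`).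
[cite: Balaban1985Variational, Thm 1 (8) p.279] -/
theorem isMinOn_regFibrePr_of_mem_argmin {V : GaugeField (F.P J) 0 (Matrix.specialUnitaryGroup (Fin 2) ℂ)}
    {U : GaugeField (F.P K) 0 (Matrix.specialUnitaryGroup (Fin 2) ℂ)}
    (hU : U ∈ {U' | U' ∈ fibre F ℰp J K hJK V ∧ U' ∈ histGood F ℰp (θBal F.L γ b₀ p₀) K J ∧
      wilsonAction4 U' = minActionRegPr F J K hJK ε₀ V})
    (hreg : RegPr F J K ε₀ U) :
    U ∈ regFibrePr F J K hJK ε₀ V ∧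
      IsMinOn (fun W : GaugeField (F.P K) 0 (Matrix.specialUnitaryGroup (Fin 2) ℂ) => wilsonAction4 W) (regFibrePr F J K hJK ε₀ V) U := by
  have hmem : U ∈ regFibrePr F J K hJK ε₀ V := (mem_regFibrePr_iff F).mpr ⟨hU.1, hreg⟩
  refine ⟨hmem, fun W hW => ?_⟩
  show wilsonAction4 U ≤ wilsonAction4 W
  rw [hU.2.2]
  exact minActionRegPr_le F hW

/-- **TWO SHEETS OF PRINT'S GROUP (4) OVER ONE BASE COMPOSE TO A RESIDUAL TRANSFORMATION**: if `U₀ = u₀ • U` and `U₁ = u₁ • U` with `u₀↓ = u₁↓ = 1`, then `U₁ = w • U₀`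
with `w := u₁u₀⁻¹` residual (`D_{J,K}(W^w) = D_{J,K}W` for every fine `W`). [cite: Balaban1985Variational, (4) p.278] -/
theorem exists_residual_of_two_sheets {U U₀ U₁ : GaugeField (F.P K) 0 (Matrix.specialUnitaryGroup (Fin 2) ℂ)}
    {u₀ u₁ : Site (F.P K) 0 → Matrix.specialUnitaryGroup (Fin 2) ℂ}
    (hu₀ : descTransf F J K hJK u₀ = fun _ => 1) (hU₀ : U₀ = GaugeField.gaugeAct u₀ U)
    (hu₁ : descTransf F J K hJK u₁ = fun _ => 1) (hU₁ : U₁ = GaugeField.gaugeAct u₁ U) :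
    ∃ w : Site (F.P K) 0 → Matrix.specialUnitaryGroup (Fin 2) ℂ,
      (∀ W : GaugeField (F.P K) 0 (Matrix.specialUnitaryGroup (Fin 2) ℂ),
          descendTo F ℰp J K hJK (GaugeField.gaugeAct w W) = descendTo F ℰp J K hJK W) ∧
        U₁ = GaugeField.gaugeAct w U₀ := by
  refine ⟨u₁ * u₀⁻¹, residual_mul F hJK (residual_of_descTransf_eq_one F hJK hu₁)
    (residual_inv F hJK (residual_of_descTransf_eq_one F hJK hu₀)), ?_⟩
  rw [hU₁, hU₀, gaugeAct_mul_eq, gaugeAct_inv_gaugeAct]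

/-- ★ **THE DOOR, PROP.-7 SHAPE**: «at most one critical orbit in (6)(ε₀)» at the carrier (`ε₀ > 0`) sends any two (6)-REGULAR points of `argminHist V` onto ONE residual orbit
(each is critical in reading R2 with `e := ε₀`; print's `SameOrbit` sheet `u↓ = 1` is residual). [cite: Balaban1985Variational, Prop. 7 p.299] -/
theorem exists_residual_eq_gaugeAct_of_atMostOneCriticalOrbit (hε₀ : 0 < ε₀)
    {V : GaugeField (F.P J) 0 (Matrix.specialUnitaryGroup (Fin 2) ℂ)} (h7 : (varProblem3 F J K hJK).AtMostOneCriticalOrbit ε₀ V)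
    {U₀ U₁ : GaugeField (F.P K) 0 (Matrix.specialUnitaryGroup (Fin 2) ℂ)}
    (hU₀ : U₀ ∈ {U' | U' ∈ fibre F ℰp J K hJK V ∧ U' ∈ histGood F ℰp (θBal F.L γ b₀ p₀) K J ∧
      wilsonAction4 U' = minActionRegPr F J K hJK ε₀ V})
    (hU₁ : U₁ ∈ {U' | U' ∈ fibre F ℰp J K hJK V ∧ U' ∈ histGood F ℰp (θBal F.L γ b₀ p₀) K J ∧
      wilsonAction4 U' = minActionRegPr F J K hJK ε₀ V})
    (hreg₀ : RegPr F J K ε₀ U₀) (hreg₁ : RegPr F J K ε₀ U₁) :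
    ∃ w : Site (F.P K) 0 → Matrix.specialUnitaryGroup (Fin 2) ℂ,
      (∀ W : GaugeField (F.P K) 0 (Matrix.specialUnitaryGroup (Fin 2) ℂ),
          descendTo F ℰp J K hJK (GaugeField.gaugeAct w W) = descendTo F ℰp J K hJK W) ∧
        U₁ = GaugeField.gaugeAct w U₀ := by
  obtain ⟨hmem₀, hmin₀⟩ := isMinOn_regFibrePr_of_mem_argmin F hJK hU₀ hreg₀
  obtain ⟨hmem₁, hmin₁⟩ := isMinOn_regFibrePr_of_mem_argmin F hJK hU₁ hreg₁
  obtain ⟨u, hu, hU⟩ := h7 U₀ U₁ hreg₀ hU₀.1 ⟨ε₀, hε₀, hmem₀, hmin₀⟩ hreg₁ hU₁.1 ⟨ε₀, hε₀, hmem₁, hmin₁⟩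
  exact ⟨u, residual_of_descTransf_eq_one F hJK hu, hU⟩

/-- ★ **THE DOOR, THM-1 SHAPE**: «the orbit of `U⋆` is the unique critical orbit in (6)(ε₀)» at the carrier (`UniqueCriticalOrbit ε₀ V U⋆`, MINIMISER reading R2) sends any two
(6)-REGULAR points of `argminHist V` onto ONE residual orbit (both are (6)-minimisers, hence on `U⋆`'s sheet-orbit; two sheets compose). [cite: Balaban1985Variational, Thm 1 (8) p.279] -/
theorem exists_residual_eq_gaugeAct_of_uniqueCriticalOrbit
    {V : GaugeField (F.P J) 0 (Matrix.specialUnitaryGroup (Fin 2) ℂ)} {Us : GaugeField (F.P K) 0 (Matrix.specialUnitaryGroup (Fin 2) ℂ)}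
    (hT : (varProblem3 F J K hJK).UniqueCriticalOrbit ε₀ V Us)
    {U₀ U₁ : GaugeField (F.P K) 0 (Matrix.specialUnitaryGroup (Fin 2) ℂ)}
    (hU₀ : U₀ ∈ {U' | U' ∈ fibre F ℰp J K hJK V ∧ U' ∈ histGood F ℰp (θBal F.L γ b₀ p₀) K J ∧
      wilsonAction4 U' = minActionRegPr F J K hJK ε₀ V})
    (hU₁ : U₁ ∈ {U' | U' ∈ fibre F ℰp J K hJK V ∧ U' ∈ histGood F ℰp (θBal F.L γ b₀ p₀) K J ∧
      wilsonAction4 U' = minActionRegPr F J K hJK ε₀ V})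
    (hreg₀ : RegPr F J K ε₀ U₀) (hreg₁ : RegPr F J K ε₀ U₁) :
    ∃ w : Site (F.P K) 0 → Matrix.specialUnitaryGroup (Fin 2) ℂ,
      (∀ W : GaugeField (F.P K) 0 (Matrix.specialUnitaryGroup (Fin 2) ℂ),
          descendTo F ℰp J K hJK (GaugeField.gaugeAct w W) = descendTo F ℰp J K hJK W) ∧
        U₁ = GaugeField.gaugeAct w U₀ := by
  obtain ⟨hmem₀, hmin₀⟩ := isMinOn_regFibrePr_of_mem_argmin F hJK hU₀ hreg₀
  obtain ⟨hmem₁, hmin₁⟩ := isMinOn_regFibrePr_of_mem_argmin F hJK hU₁ hreg₁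
  obtain ⟨u₀, hu₀, hU₀'⟩ := hT.2 U₀ hmem₀ hmin₀
  obtain ⟨u₁, hu₁, hU₁'⟩ := hT.2 U₁ hmem₁ hmin₁
  exact exists_residual_of_two_sheets F hJK hu₀ hU₀' hu₁ hU₁'

/-- **THE THM-1 PAIR AT CONSTANTS FEEDS THE DOOR**: `Thm1GlobalMinAt L a₀ a₁ B₃` puts a minimiser `U⋆` over (6)(ε₀) into (8)(B₃ε₁) (so `U⋆` is on the minimal orbit in (8), (8) ⊆ (6)),
and `Thm1UniqueMinOrbitAt L a₀ a₁ B₃` makes its orbit the unique critical orbit in (6)(ε₀) — for a member `F` (`F.L = L`), `J < K`, `0 < ε₁ ≤ a₁`, `B₃ε₁ ≤ ε₀ ≤ a₀` and a (7)-datum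
`PlaqSmall ε₁ V`. [cite: Balaban1985Variational, Thm 1 (8) p.279] -/
theorem exists_uniqueCriticalOrbit_of_thm1Pair {L : ℕ} {a₀ a₁ B₃ : ℝ} (hT : Thm1GlobalMinAt L a₀ a₁ B₃) (hU : Thm1UniqueMinOrbitAt L a₀ a₁ B₃)
    (hFL : F.L = L) (hlt : J < K) {ε₁ : ℝ} (hε₁ : 0 < ε₁) (hε₁a : ε₁ ≤ a₁) (hlo : B₃ * ε₁ ≤ ε₀) (hhi : ε₀ ≤ a₀)
    {V : GaugeField (F.P J) 0 (Matrix.specialUnitaryGroup (Fin 2) ℂ)} (hV : PlaqSmall ε₁ V) :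
    ∃ Us : GaugeField (F.P K) 0 (Matrix.specialUnitaryGroup (Fin 2) ℂ), (varProblem3 F J K hlt.le).UniqueCriticalOrbit ε₀ V Us := by
  obtain ⟨Us, hUs8, hmin⟩ := hT F hFL J K hlt ε₁ ε₀ hε₁ hε₁a hlo hhi V hV
  have hmin8 : IsMinOn (fun W : GaugeField (F.P K) 0 (Matrix.specialUnitaryGroup (Fin 2) ℂ) => wilsonAction4 W)
      (regFibrePr F J K hlt.le (B₃ * ε₁) V) Us := hmin.on_subset (regFibrePr_mono F hlo V)
  exact ⟨Us, hU F hFL J K hlt ε₁ ε₀ hε₁ hε₁a hlo hhi V hV Us ⟨hUs8, hmin8⟩⟩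

end Door
/-! ## §2 Shallow depth is free: good-history fields are (6)-regular once `θBal(K)` is below the (6)-thresholds -/

section Shallow
variable (F : T3Family) {J K : ℕ} {γ b₀ p₀ ε₀ : ℝ}

/-- **A GOOD-HISTORY FIELD IS (6)-REGULAR AT SHALLOW DEPTH**: the `j = 0` clause of `histGood(θBal b₀) K J` is `PlaqSmall (θBal F.L γ b₀ p₀ K) U` (`Averaging.iter _ 0 = id`); if
`θBal(K) ≤ ε₀L^{−2(K−J)}` and `4θBal(K) < ε₀L^{−3(K−J)}`, both clauses of [7] (2) follow (lit ✓`regPr_of_plaqSmall`). [cite: Balaban1985Variational, (2) p.278] -/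
theorem regPr_of_mem_histGood_of_le (hJK : J ≤ K) {U : GaugeField (F.P K) 0 (Matrix.specialUnitaryGroup (Fin 2) ℂ)}
    (hU : U ∈ histGood F ℰp (θBal F.L γ b₀ p₀) K J)
    (hθ : θBal F.L γ b₀ p₀ K ≤ regThreshold F J K ε₀) (h4 : 4 * θBal F.L γ b₀ p₀ K < ε₀ * ((F.L : ℝ)⁻¹) ^ (3 * (K - J))) :
    RegPr F J K ε₀ U := by
  have h0 : PlaqSmall (θBal F.L γ b₀ p₀ K) U := by
    have h := hU 0 (by omega)
    rw [Nat.sub_zero] at h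
    exact h
  exact regPr_of_plaqSmall F h0 hθ h4

/-- **REG-ARGMIN AT SHALLOW DEPTH** (the displayed letter of §3, discharged): every point of `argminHist V` is (6)-regular. [cite: Balaban1985Variational, (6) p.278] -/
theorem regArgmin_of_le (hJK : J ≤ K) (V : GaugeField (F.P J) 0 (Matrix.specialUnitaryGroup (Fin 2) ℂ))
    (hθ : θBal F.L γ b₀ p₀ K ≤ regThreshold F J K ε₀) (h4 : 4 * θBal F.L γ b₀ p₀ K < ε₀ * ((F.L : ℝ)⁻¹) ^ (3 * (K - J))) :
    ∀ U' ∈ {U' | U' ∈ fibre F ℰp J K hJK V ∧ U' ∈ histGood F ℰp (θBal F.L γ b₀ p₀) K J ∧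
      wilsonAction4 U' = minActionRegPr F J K hJK ε₀ V}, RegPr F J K ε₀ U' :=
  fun _ hU => regPr_of_mem_histGood_of_le F hJK hU.2.1 hθ h4

/-- The two shallow-depth inequalities from ONE smallness `θBal(K) ≤ ε₀L^{−3d}/5` at any depth `K − J ≤ d` (`L ≥ 1`: `L^{−3d} ≤ L^{−3(K−J)} ≤ L^{−2(K−J)}`).
[cite: Balaban1985Variational, (2) p.278] -/
theorem shallow_of_le_div_five {d : ℕ} (hd : K - J ≤ d) (hε₀ : 0 < ε₀)
    (h : θBal F.L γ b₀ p₀ K ≤ ε₀ * ((F.L : ℝ)⁻¹) ^ (3 * d) / 5) :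
    θBal F.L γ b₀ p₀ K ≤ regThreshold F J K ε₀ ∧ 4 * θBal F.L γ b₀ p₀ K < ε₀ * ((F.L : ℝ)⁻¹) ^ (3 * (K - J)) := by
  have hL1 : (1 : ℝ) ≤ (F.L : ℝ) := by exact_mod_cast F.hL.2.le
  have hi0 : (0 : ℝ) ≤ (F.L : ℝ)⁻¹ := inv_nonneg.mpr (Nat.cast_nonneg _)
  have hi1 : (F.L : ℝ)⁻¹ ≤ 1 := inv_le_one_of_one_le₀ hL1
  have hp3 : ((F.L : ℝ)⁻¹) ^ (3 * d) ≤ ((F.L : ℝ)⁻¹) ^ (3 * (K - J)) := pow_le_pow_of_le_one hi0 hi1 (by omega)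
  have hp2 : ((F.L : ℝ)⁻¹) ^ (3 * (K - J)) ≤ ((F.L : ℝ)⁻¹) ^ (2 * (K - J)) := pow_le_pow_of_le_one hi0 hi1 (by omega)
  have hpos : 0 < ε₀ * ((F.L : ℝ)⁻¹) ^ (3 * (K - J)) := mul_pos hε₀ (pow_pos (inv_pos.mpr (by linarith)) _)
  have h3 : θBal F.L γ b₀ p₀ K ≤ ε₀ * ((F.L : ℝ)⁻¹) ^ (3 * (K - J)) / 5 :=
    h.trans (div_le_div_of_nonneg_right (mul_le_mul_of_nonneg_left hp3 hε₀.le) (by norm_num))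
  have h2' := mul_le_mul_of_nonneg_left hp2 hε₀.le
  exact ⟨by unfold regThreshold; linarith, by linarith⟩

end Shallow
/-! ## §3 The window theorems: ORB from the Prop-7 letter modulo REG-ARGMIN (displayed), and outright at bounded depth -/

section Window
/-- The corner `J = K` and the general residual-orbit bookkeeping: if every two points of the argmin set are residually related, the argmin set IS the residual orbit of any of
its points (⊇: residual translates of an argmin point are argmin points, ✓`gaugeAct_mem_argmin_iff_of_residual`). [cite: Balaban1985Variational, Thm 1 (8)-(10) p.279] -/
theorem argmin_eq_orbit_of_pairwise (F : T3Family) {J K : ℕ} (hJK : J ≤ K) {γ b₀ p₀ ε₀ : ℝ}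
    (V : GaugeField (F.P J) 0 (Matrix.specialUnitaryGroup (Fin 2) ℂ))
    (hpair : ∀ U₀ ∈ {U' | U' ∈ fibre F ℰp J K hJK V ∧ U' ∈ histGood F ℰp (θBal F.L γ b₀ p₀) K J ∧
        wilsonAction4 U' = minActionRegPr F J K hJK ε₀ V},
      ∀ U₁ ∈ {U' | U' ∈ fibre F ℰp J K hJK V ∧ U' ∈ histGood F ℰp (θBal F.L γ b₀ p₀) K J ∧
        wilsonAction4 U' = minActionRegPr F J K hJK ε₀ V},
        ∃ w : Site (F.P K) 0 → Matrix.specialUnitaryGroup (Fin 2) ℂ,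
          (∀ W : GaugeField (F.P K) 0 (Matrix.specialUnitaryGroup (Fin 2) ℂ),
              descendTo F ℰp J K hJK (GaugeField.gaugeAct w W) = descendTo F ℰp J K hJK W) ∧
            U₁ = GaugeField.gaugeAct w U₀) :
    ∀ U₀ ∈ {U' | U' ∈ fibre F ℰp J K hJK V ∧ U' ∈ histGood F ℰp (θBal F.L γ b₀ p₀) K J ∧
        wilsonAction4 U' = minActionRegPr F J K hJK ε₀ V},
      {U' | U' ∈ fibre F ℰp J K hJK V ∧ U' ∈ histGood F ℰp (θBal F.L γ b₀ p₀) K J ∧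
          wilsonAction4 U' = minActionRegPr F J K hJK ε₀ V} =
        {U | ∃ w : Site (F.P K) 0 → Matrix.specialUnitaryGroup (Fin 2) ℂ,
          (∀ U' : GaugeField (F.P K) 0 (Matrix.specialUnitaryGroup (Fin 2) ℂ),
              descendTo F ℰp J K hJK (GaugeField.gaugeAct w U') = descendTo F ℰp J K hJK U') ∧
            U = GaugeField.gaugeAct w U₀} := by
  intro U₀ hU₀
  refine Set.Subset.antisymm (fun U hU => hpair U₀ hU₀ U hU) (fun U hU => ?_)
  obtain ⟨w, hw, hUw⟩ := hU
  rw [hUw]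
  exact (gaugeAct_mem_argmin_iff_of_residual F hJK hw U₀ V).mpr hU₀

/-- Over the corner `J = K` the fibre is `{V}` (✓`fibre_self`), so any two argmin points coincide and `w := 1` relates them. [cite: Balaban1985Variational, (6) p.278] -/
theorem pairwise_of_self (F : T3Family) (K : ℕ) (hKK : K ≤ K) {γ b₀ p₀ ε₀ : ℝ}
    (V : GaugeField (F.P K) 0 (Matrix.specialUnitaryGroup (Fin 2) ℂ)) :
    ∀ U₀ ∈ {U' | U' ∈ fibre F ℰp K K hKK V ∧ U' ∈ histGood F ℰp (θBal F.L γ b₀ p₀) K K ∧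
        wilsonAction4 U' = minActionRegPr F K K hKK ε₀ V},
      ∀ U₁ ∈ {U' | U' ∈ fibre F ℰp K K hKK V ∧ U' ∈ histGood F ℰp (θBal F.L γ b₀ p₀) K K ∧
        wilsonAction4 U' = minActionRegPr F K K hKK ε₀ V},
        ∃ w : Site (F.P K) 0 → Matrix.specialUnitaryGroup (Fin 2) ℂ,
          (∀ W : GaugeField (F.P K) 0 (Matrix.specialUnitaryGroup (Fin 2) ℂ),
              descendTo F ℰp K K hKK (GaugeField.gaugeAct w W) = descendTo F ℰp K K hKK W) ∧
            U₁ = GaugeField.gaugeAct w U₀ := by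
  intro U₀ hU₀ U₁ hU₁
  have hfib : fibre F ℰp K K hKK V = {V} := fibre_self F ℰp K V
  have h₀ : U₀ = V := by have h := hU₀.1; rw [hfib] at h; exact h
  have h₁ : U₁ = V := by have h := hU₁.1; rw [hfib] at h; exact h
  refine ⟨1, residual_one F hKK, ?_⟩
  rw [h₁, h₀]
  exact (B12RTGaugeInvariance254.gaugeAct_one' V).symm

/-- ★★ **ORB ON THE INTERIOR WINDOW ⟸ THE PROP.-7 LETTER, MODULO THE DISPLAYED LETTER REG-ARGMIN.**  Hypothesis `h7` = [Balaban1985Variational] Prop. 7 clause 1 at every odd block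
size (`Prop7AtMostOneCriticalOrbitAt L a₀ B₃`, never asserted).  Conclusion: GAP♯∘'s quantifier prefix (`c₀ := min 1 B₃⁻¹`, `pS := 0`, `ε₁ := a₀`, `γ₁(L, b₀, p₀, ε₀)` := the smaller of
`1` and lit ✓`exists_forall_θBal_le` at `ε₀`, so that `B₃·θBal(cw b₀)(J) ≤ θBal(b₀)(J) ≤ ε₀`) and interior window `PlaqSmall (θBal F.L γ (cw * b₀) p₀ J) V` VERBATIM, then
«REG-ARGMIN(V) := every point of `argminHist V` is (6)-regular» DISPLAYED as an inner hypothesis, then «for every `U₀ ∈ argminHist V`, `argminHist V = {w • U₀ | w residual}`».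
Thm-1 letter used at `n := J < K`, `ε₁ := θBal F.L γ (cw·b₀) p₀ J` (the datum's own window), `ε₀` the display's; corner `J = K` by ✓`fibre_self`.
REG-ARGMIN is NOT printed at unbounded depth (LOCATE-ORB px17 g14); §2 discharges it at bounded depth (next theorem). [cite: Balaban1985Variational, Prop. 7 p.299] -/
theorem argmin_eq_orbit_of_prop7_of_regArgmin
    (h7 : ∀ L : ℕ, Odd L → 1 < L → ∃ a₀ B₃ : ℝ, 0 < a₀ ∧ 0 < B₃ ∧ Prop7AtMostOneCriticalOrbitAt L a₀ B₃) :
    ∀ (L : ℕ), ∃ c₀ : ℝ, 0 < c₀ ∧ c₀ ≤ 1 ∧ ∀ (cw : ℝ), 0 < cw → cw ≤ c₀ → ∃ pS : ℝ, ∀ (b₀ p₀ : ℝ), 0 < b₀ → pS ≤ p₀ → 0 < p₀ →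
      ∃ ε₁ : ℝ, 0 < ε₁ ∧ ∀ (ε₀ : ℝ), 0 < ε₀ → ε₀ ≤ ε₁ →
      ∃ γ₁ : ℝ, 0 < γ₁ ∧ ∀ (F : T3Family) (γ : ℝ), F.L = L → 0 < γ → γ ≤ γ₁ →
        ∀ (J K : ℕ) (hJK : J ≤ K) (V : GaugeField (F.P J) 0 (Matrix.specialUnitaryGroup (Fin 2) ℂ)), PlaqSmall (θBal F.L γ (cw * b₀) p₀ J) V →
          (∀ U' ∈ {U' | U' ∈ fibre F ℰp J K hJK V ∧ U' ∈ histGood F ℰp (θBal F.L γ b₀ p₀) K J ∧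
              wilsonAction4 U' = minActionRegPr F J K hJK ε₀ V}, RegPr F J K ε₀ U') →
          ∀ U₀ ∈ {U' | U' ∈ fibre F ℰp J K hJK V ∧ U' ∈ histGood F ℰp (θBal F.L γ b₀ p₀) K J ∧
              wilsonAction4 U' = minActionRegPr F J K hJK ε₀ V},
            {U' | U' ∈ fibre F ℰp J K hJK V ∧ U' ∈ histGood F ℰp (θBal F.L γ b₀ p₀) K J ∧
                wilsonAction4 U' = minActionRegPr F J K hJK ε₀ V} =
              {U | ∃ w : Site (F.P K) 0 → Matrix.specialUnitaryGroup (Fin 2) ℂ,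
                (∀ U' : GaugeField (F.P K) 0 (Matrix.specialUnitaryGroup (Fin 2) ℂ),
                    descendTo F ℰp J K hJK (GaugeField.gaugeAct w U') = descendTo F ℰp J K hJK U') ∧
                  U = GaugeField.gaugeAct w U₀} := by
  intro L
  by_cases hLodd : Odd L ∧ 1 < L
  swap
  · -- no family has this block size: everything is vacuous
    refine ⟨1, one_pos, le_rfl, fun cw _ _ => ⟨0, fun b₀ p₀ _ _ _ => ⟨1, one_pos, fun ε₀ _ _ => ⟨1, one_pos, ?_⟩⟩⟩⟩
    intro F γ hFL
    exact absurd (hFL ▸ F.hL) hLodd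
  obtain ⟨a₀, B₃, ha₀, hB₃, h7L⟩ := h7 L hLodd.1 hLodd.2
  have hL : 1 ≤ L := hLodd.2.le
  refine ⟨min 1 B₃⁻¹, lt_min one_pos (inv_pos.mpr hB₃), min_le_left _ _, fun cw hcw0 hcwle => ?_⟩
  have hcw1 : cw ≤ 1 := hcwle.trans (min_le_left _ _)
  have hcB : B₃ * cw ≤ 1 := by
    have h := mul_le_mul_of_nonneg_left (hcwle.trans (min_le_right _ _)) hB₃.le
    rwa [mul_inv_cancel₀ hB₃.ne'] at h
  refine ⟨0, fun b₀ p₀ hb _ _ => ⟨a₀, ha₀, fun ε₀ hε₀ hε₀a => ?_⟩⟩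
  obtain ⟨γb, hγb, Hb⟩ := exists_forall_θBal_le hL b₀ p₀ hε₀
  refine ⟨min γb 1, lt_min hγb one_pos, fun F γ hFL hγ hγle J K hJK V hV hRA => ?_⟩
  have hγb' : γ ≤ γb := hγle.trans (min_le_left _ _)
  have hγ1 : γ ≤ 1 := hγle.trans (min_le_right _ _)
  refine argmin_eq_orbit_of_pairwise F hJK V ?_
  rcases Nat.eq_or_lt_of_le hJK with hEq | hlt
  · subst hEq
    exact pairwise_of_self F J hJK V
  · -- `J < K`: Prop. 7 clause 1 at the datum's own window radius
    have hε₁ : 0 < θBal F.L γ (cw * b₀) p₀ J := θBal_pos F.hL.2.le hγ hγ1 (mul_pos hcw0 hb) p₀ J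
    have hlo : B₃ * θBal F.L γ (cw * b₀) p₀ J ≤ ε₀ := by
      have h1 : B₃ * θBal F.L γ (cw * b₀) p₀ J ≤ θBal F.L γ b₀ p₀ J := by
        rw [θBal_mul, ← mul_assoc]
        exact mul_le_of_le_one_left (θBal_pos F.hL.2.le hγ hγ1 hb p₀ J).le hcB
      have h2 : θBal F.L γ b₀ p₀ J ≤ ε₀ := by rw [hFL]; exact Hb γ hγ hγb' J
      exact h1.trans h2
    have hA := h7L F hFL J K hlt _ ε₀ hε₁ hlo hε₀a V hV
    intro U₀ hU₀ U₁ hU₁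
    exact exists_residual_eq_gaugeAct_of_atMostOneCriticalOrbit F hJK hε₀ hA hU₀ hU₁ (hRA U₀ hU₀) (hRA U₁ hU₁)

/-- ★★ **ORB ON THE INTERIOR WINDOW AT BOUNDED DEPTH `K − J ≤ d` ⟸ THE PROP.-7 LETTER ALONE** (REG-ARGMIN discharged by §2: `γ₁` now also below lit ✓`exists_forall_θBal_le` at
`ε₀L^{−3d}/5`, so `θBal(K) ≤ ε₀L^{−2(K−J)}` and `4θBal(K) < ε₀L^{−3(K−J)}`).  Same prefix and window as ★★₁ with `d` quantified after `L` and the guard `K − J ≤ d` after `hJK`; no inner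
letter. [cite: Balaban1985Variational, Prop. 7 p.299 and (2) p.278] -/
theorem argmin_eq_orbit_of_prop7_of_depth_le
    (h7 : ∀ L : ℕ, Odd L → 1 < L → ∃ a₀ B₃ : ℝ, 0 < a₀ ∧ 0 < B₃ ∧ Prop7AtMostOneCriticalOrbitAt L a₀ B₃) :
    ∀ (L d : ℕ), ∃ c₀ : ℝ, 0 < c₀ ∧ c₀ ≤ 1 ∧ ∀ (cw : ℝ), 0 < cw → cw ≤ c₀ → ∃ pS : ℝ, ∀ (b₀ p₀ : ℝ), 0 < b₀ → pS ≤ p₀ → 0 < p₀ →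
      ∃ ε₁ : ℝ, 0 < ε₁ ∧ ∀ (ε₀ : ℝ), 0 < ε₀ → ε₀ ≤ ε₁ →
      ∃ γ₁ : ℝ, 0 < γ₁ ∧ ∀ (F : T3Family) (γ : ℝ), F.L = L → 0 < γ → γ ≤ γ₁ →
        ∀ (J K : ℕ) (hJK : J ≤ K), K - J ≤ d → ∀ (V : GaugeField (F.P J) 0 (Matrix.specialUnitaryGroup (Fin 2) ℂ)), PlaqSmall (θBal F.L γ (cw * b₀) p₀ J) V →
          ∀ U₀ ∈ {U' | U' ∈ fibre F ℰp J K hJK V ∧ U' ∈ histGood F ℰp (θBal F.L γ b₀ p₀) K J ∧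
              wilsonAction4 U' = minActionRegPr F J K hJK ε₀ V},
            {U' | U' ∈ fibre F ℰp J K hJK V ∧ U' ∈ histGood F ℰp (θBal F.L γ b₀ p₀) K J ∧
                wilsonAction4 U' = minActionRegPr F J K hJK ε₀ V} =
              {U | ∃ w : Site (F.P K) 0 → Matrix.specialUnitaryGroup (Fin 2) ℂ,
                (∀ U' : GaugeField (F.P K) 0 (Matrix.specialUnitaryGroup (Fin 2) ℂ),
                    descendTo F ℰp J K hJK (GaugeField.gaugeAct w U') = descendTo F ℰp J K hJK U') ∧
                  U = GaugeField.gaugeAct w U₀} := by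
  intro L d
  obtain ⟨c₀, hc₀, hc₀1, H⟩ := argmin_eq_orbit_of_prop7_of_regArgmin h7 L
  refine ⟨c₀, hc₀, hc₀1, fun cw hcw0 hcwle => ?_⟩
  obtain ⟨pS, H1⟩ := H cw hcw0 hcwle
  refine ⟨pS, fun b₀ p₀ hb hpS hp => ?_⟩
  obtain ⟨ε₁, hε₁, H2⟩ := H1 b₀ p₀ hb hpS hp
  refine ⟨ε₁, hε₁, fun ε₀ hε₀ hε₀le => ?_⟩
  obtain ⟨γ₁, hγ₁, H3⟩ := H2 ε₀ hε₀ hε₀le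
  by_cases hL : 1 ≤ L
  swap
  · -- no family has block size `0`: vacuous
    refine ⟨γ₁, hγ₁, fun F γ hFL => ?_⟩
    exact absurd (hFL ▸ F.hL.2.le) hL
  have hx : 0 < ε₀ * ((L : ℝ)⁻¹) ^ (3 * d) / 5 := by
    have hL0 : (0 : ℝ) < L := by exact_mod_cast hL
    positivity
  obtain ⟨γs, hγs, Hs⟩ := exists_forall_θBal_le hL b₀ p₀ hx
  refine ⟨min γ₁ γs, lt_min hγ₁ hγs, fun F γ hFL hγ hγle J K hJK hd V hV => ?_⟩
  have hsh : θBal F.L γ b₀ p₀ K ≤ regThreshold F J K ε₀ ∧ 4 * θBal F.L γ b₀ p₀ K < ε₀ * ((F.L : ℝ)⁻¹) ^ (3 * (K - J)) := by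
    refine shallow_of_le_div_five F hd hε₀ ?_
    rw [hFL]
    exact Hs γ hγ (hγle.trans (min_le_right _ _)) K
  exact H3 F γ hFL hγ (hγle.trans (min_le_left _ _)) J K hJK V hV (regArgmin_of_le F hJK V hsh.1 hsh.2)

/-- ★ **THE SAME DOOR FROM THE THM-1 PAIR LETTER** ([Balaban1985Variational] Thm 1 existence (8) ∧ sentence 2 at shared constants, `Thm1GlobalMinAt ∧ Thm1UniqueMinOrbitAt`, never
asserted): prefix as ★★₁ with `ε₁ := a₀` and `γ₁` additionally below lit ✓`exists_forall_θBal_le` at `a₁` (so the datum radius `θBal(cw b₀)(J) ≤ a₁`); REG-ARGMIN displayed.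
[cite: Balaban1985Variational, Thm 1 (8) p.279] -/
theorem argmin_eq_orbit_of_thm1Pair_of_regArgmin
    (hT : ∀ L : ℕ, Odd L → 1 < L → ∃ a₀ a₁ B₃ : ℝ, 0 < a₀ ∧ 0 < a₁ ∧ 0 < B₃ ∧ Thm1GlobalMinAt L a₀ a₁ B₃ ∧ Thm1UniqueMinOrbitAt L a₀ a₁ B₃) :
    ∀ (L : ℕ), ∃ c₀ : ℝ, 0 < c₀ ∧ c₀ ≤ 1 ∧ ∀ (cw : ℝ), 0 < cw → cw ≤ c₀ → ∃ pS : ℝ, ∀ (b₀ p₀ : ℝ), 0 < b₀ → pS ≤ p₀ → 0 < p₀ →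
      ∃ ε₁ : ℝ, 0 < ε₁ ∧ ∀ (ε₀ : ℝ), 0 < ε₀ → ε₀ ≤ ε₁ →
      ∃ γ₁ : ℝ, 0 < γ₁ ∧ ∀ (F : T3Family) (γ : ℝ), F.L = L → 0 < γ → γ ≤ γ₁ →
        ∀ (J K : ℕ) (hJK : J ≤ K) (V : GaugeField (F.P J) 0 (Matrix.specialUnitaryGroup (Fin 2) ℂ)), PlaqSmall (θBal F.L γ (cw * b₀) p₀ J) V →
          (∀ U' ∈ {U' | U' ∈ fibre F ℰp J K hJK V ∧ U' ∈ histGood F ℰp (θBal F.L γ b₀ p₀) K J ∧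
              wilsonAction4 U' = minActionRegPr F J K hJK ε₀ V}, RegPr F J K ε₀ U') →
          ∀ U₀ ∈ {U' | U' ∈ fibre F ℰp J K hJK V ∧ U' ∈ histGood F ℰp (θBal F.L γ b₀ p₀) K J ∧
              wilsonAction4 U' = minActionRegPr F J K hJK ε₀ V},
            {U' | U' ∈ fibre F ℰp J K hJK V ∧ U' ∈ histGood F ℰp (θBal F.L γ b₀ p₀) K J ∧
                wilsonAction4 U' = minActionRegPr F J K hJK ε₀ V} =
              {U | ∃ w : Site (F.P K) 0 → Matrix.specialUnitaryGroup (Fin 2) ℂ,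
                (∀ U' : GaugeField (F.P K) 0 (Matrix.specialUnitaryGroup (Fin 2) ℂ),
                    descendTo F ℰp J K hJK (GaugeField.gaugeAct w U') = descendTo F ℰp J K hJK U') ∧
                  U = GaugeField.gaugeAct w U₀} := by
  intro L
  by_cases hLodd : Odd L ∧ 1 < L
  swap
  · refine ⟨1, one_pos, le_rfl, fun cw _ _ => ⟨0, fun b₀ p₀ _ _ _ => ⟨1, one_pos, fun ε₀ _ _ => ⟨1, one_pos, ?_⟩⟩⟩⟩
    intro F γ hFL
    exact absurd (hFL ▸ F.hL) hLodd
  obtain ⟨a₀, a₁, B₃, ha₀, ha₁, hB₃, hT1, hU1⟩ := hT L hLodd.1 hLodd.2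
  have hL : 1 ≤ L := hLodd.2.le
  refine ⟨min 1 B₃⁻¹, lt_min one_pos (inv_pos.mpr hB₃), min_le_left _ _, fun cw hcw0 hcwle => ?_⟩
  have hcB : B₃ * cw ≤ 1 := by
    have h := mul_le_mul_of_nonneg_left (hcwle.trans (min_le_right _ _)) hB₃.le
    rwa [mul_inv_cancel₀ hB₃.ne'] at h
  refine ⟨0, fun b₀ p₀ hb _ _ => ⟨a₀, ha₀, fun ε₀ hε₀ hε₀a => ?_⟩⟩
  obtain ⟨γb, hγb, Hb⟩ := exists_forall_θBal_le hL b₀ p₀ (lt_min hε₀ ha₁)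
  refine ⟨min γb 1, lt_min hγb one_pos, fun F γ hFL hγ hγle J K hJK V hV hRA => ?_⟩
  have hγb' : γ ≤ γb := hγle.trans (min_le_left _ _)
  have hγ1 : γ ≤ 1 := hγle.trans (min_le_right _ _)
  refine argmin_eq_orbit_of_pairwise F hJK V ?_
  rcases Nat.eq_or_lt_of_le hJK with hEq | hlt
  · subst hEq
    exact pairwise_of_self F J hJK V
  · have hε₁ : 0 < θBal F.L γ (cw * b₀) p₀ J := θBal_pos F.hL.2.le hγ hγ1 (mul_pos hcw0 hb) p₀ J
    have hθb : θBal F.L γ b₀ p₀ J ≤ min ε₀ a₁ := by rw [hFL]; exact Hb γ hγ hγb' J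
    have hcw1 : cw ≤ 1 := hcwle.trans (min_le_left _ _)
    have hε₁a : θBal F.L γ (cw * b₀) p₀ J ≤ a₁ :=
      ((θBal_mul_le F.hL.2.le hγ hγ1 hb hcw1 p₀ J).trans hθb).trans (min_le_right _ _)
    have hlo : B₃ * θBal F.L γ (cw * b₀) p₀ J ≤ ε₀ := by
      have h1 : B₃ * θBal F.L γ (cw * b₀) p₀ J ≤ θBal F.L γ b₀ p₀ J := by
        rw [θBal_mul, ← mul_assoc]
        exact mul_le_of_le_one_left (θBal_pos F.hL.2.le hγ hγ1 hb p₀ J).le hcB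
      exact h1.trans (hθb.trans (min_le_left _ _))
    obtain ⟨Us, hUs⟩ := exists_uniqueCriticalOrbit_of_thm1Pair F hT1 hU1 hFL hlt hε₁ hε₁a hlo hε₀a hV
    intro U₀ hU₀ U₁ hU₁
    exact exists_residual_eq_gaugeAct_of_uniqueCriticalOrbit F hJK hUs hU₀ hU₁ (hRA U₀ hU₀) (hRA U₁ hU₁)

end Window
end Summit.QuantumFields.YangMills.Theorems.FluctuationComparisonRegPrIntLArgminOrbitOfUniqueCriticalOrbit

end
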